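import Summits.KontsevichZagierPeriods.KontsevichZagierPeriods.Theorems.RootDecompRelativeModAbsoluteRegKernelPairLeOneP09
import Summits.KontsevichZagierPeriods.KontsevichZagierPeriods.Theorems.RootDecompRelativeModAbsoluteRegFoldingDegOneP13

/-!
(LANDED by the census seat decomp-kz-census-1 g7 `--supports stmt-KontsevichZagierPeriods-30572`; source lens-3 g9 landing package #2 / CylKernelZero Inline fallback, critic decomp-kz-crit-1 g2 CLEARED §14–§19; generic docstrings added where the source had none.)

# `RegKernelPairDegOne`, the COMMON-`κ₀ > 0` case with BOTH KINDS (route `RootDecompRelativeModAbsolute`,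
support item stmt-KontsevichZagierPeriods-30572) — PROVED · part 10 (the squaring move and the mixed rigidity)

Cell `decomp-kz`, lens 3 (decomp-kz-lens-3 g9), §18 of the HOME file.  Item 30572 for ANY numbers `k, k'` of
regularised monomials of EITHER kind (`eᵢ, e'ⱼ ∈ {1,2}` free per monomial) sharing ONE argument function
`κ₀ > 0` (`κᵢ = κ'ⱼ = κ₀`, `ℚ`-semialgebraic on `G ∪ G'`).  The fibre numbers obey `ℓ_{2j+1,2}(κ) = ℓ_{j,1}(κ)/2`,
so this rung needs ONE genuine change of variables (Kontsevich–Zagier rule (2), tree generator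
`KZ.changeOfVariablesRel`): the fibrewise squaring `(x,θ) ↦ (x,θ²)` on the OPEN cylinder, turning odd
arctan-kind monomials into log-kind ones; Baker (mixed form) then kills the log-kind and the even-arctan-kind
remainders.  This part: `exists_sqSubst` (the squaring move on `G × (0,1)`, integrability transported by Mathlib's Jacobian criterion), `ell_odd_two`, and the mixed rigidity `mixed_rem_scalar` / `mixed_rem_ae_eq_zero` (from `CircleBaker.log_arctan` of part 4).

Source: `HOME/decomp-kz-lens-3/g9/RelativeModAbsoluteDegOneBands.lean` §18 (v6 sha256 720470ba3a4f13d9, 8617 l;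
farm rc 0 / 0 warn / 0 sorry; `#print axioms regKernelPairDegOne_of_commonPos` = propext, Classical.choice,
Quot.sound), extracted verbatim into the namespace of the landed chain.  No `sorry`; standard axioms.
References: Baker 1975 Thm 2.1 [tree: `baker_holds`]; [cite: KontsevichZagier2001, §1.2]; Bochnak–Coste–Roy 1998 §2.9.
-/

noncomputable section

open Set MeasureTheory Filter Topology
open scoped BigOperators
open Literature.NumberTheory.Transcendental Literature.ModelTheory.ExponentialFields

namespace Summit.KontsevichZagierPeriods.RootDecompRelativeModAbsolute.Rung30571

namespace RegularisedLogLayer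

/-! ## §18 (g9). Common argument function `κ₀ > 0`, MIXED kinds — the squaring move

With one common `κ₀ > 0` but monomials of BOTH kinds the fibre numbers satisfy the functional
identity `ℓ_{2j+1,2}(κ) = ℓ_{j,1}(κ)/2` (`∫₀¹ θ^{2j+1}/(1+κθ²) dθ = ½∫₀¹ w^j/(1+κw) dw`), so the
remainders of the Taylor divisions need NOT vanish separately; the resulting relation is realised in
`KZ.relations` by ONE genuine change of variables, the fibrewise squaring `(x, θ) ↦ (x, θ²)` on the open
cylinder (Kontsevich–Zagier's rule (2); `KZ.changeOfVariablesRel`), which turns every odd arctan-kind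
monomial into a log-kind one. This section supplies that move (`exists_sqSubst`, with the
integrability of the substituted integrand transported by Mathlib's Jacobian criterion), the scalar
identity (`ell_odd_two`), the mixed rigidity (`mixed_rem_ae_eq_zero`: Baker in the mixed form kills the
log-kind and the even-arctan-kind remainders), the core lemma for "log-kind + even-arctan-kind"
integrands (`cyl_logEven_mem_relations`) and the rung `regKernelPairDegOne_of_commonPos`.
-/

section SqSubst

/-- `w = (init w, 0) + w_last · e_last` (copy of the private splitting lemma of `KZFibreMapMove`). -/
private theorem eq_snoc_init_zero_add' (m : ℕ) (w : Fin (m + 1) → ℝ) :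
    w = Fin.snoc (Fin.init w) (0 : ℝ) +
      w (Fin.last m) • (Pi.single (Fin.last m) (1 : ℝ) : Fin (m + 1) → ℝ) := by
  ext i
  refine Fin.lastCases ?_ (fun j => ?_) i
  · simp
  · simp [(Fin.castSucc_lt_last j).ne, Fin.init]

/-- **The squaring substitution along the last coordinate** on an open cylinder `G × (0,1)`:
if `r.integrand (y, s) = g (y, s²) · 2s` on `r.domain = G × (0,1)` with `g` `ℚ`-semialgebraic there, then
`g` is integrable on the cylinder and `[r] − [G × (0,1), g]` is ONE change-of-variables move
(`Φ (y, s) = (y, s²)`, Jacobian `2s`, a bijection of the cylinder). Adapted from the tree's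
`KZ.of_sub_of_mem_relations_of_fibreMap` (closed bands) to open cylinders.
[KZ 2001 §1.2 rule (2); folklore] -/
theorem exists_sqSubst {m : ℕ} {G : Set (Fin m → ℝ)} (r : KZ.IntegralRep (m + 1))
    (hr : r.domain = {z : Fin (m + 1) → ℝ | (Fin.init z : Fin m → ℝ) ∈ G ∧ z (Fin.last m) ∈ Ioo (0 : ℝ) 1})
    {g : (Fin (m + 1) → ℝ) → ℝ} (hg : IsSemialgebraicFunOn ℚ r.domain g)
    (hint : ∀ z ∈ r.domain, r.integrand z =
      g (Fin.snoc (Fin.init z) (z (Fin.last m) ^ 2)) * (2 * z (Fin.last m))) :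
    ∃ r' : KZ.IntegralRep (m + 1), r'.domain = r.domain ∧ r'.integrand = g ∧
      KZ.of r - KZ.of r' ∈ KZ.relations := by
  have hlast_mem : ∀ z ∈ r.domain, z (Fin.last m) ∈ Ioo (0 : ℝ) 1 := fun z hz => by
    rw [hr] at hz; exact hz.2
  -- `ψ (y, s) = s²`, `ψs = 2s`
  set ψ : (Fin (m + 1) → ℝ) → ℝ := fun z => z (Fin.last m) ^ 2 with hψ
  have hψd : ∀ z, DifferentiableAt ℝ ψ z := fun z =>
    (differentiableAt_apply (𝕜 := ℝ) (Fin.last m) z).pow 2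
  have hψs : ∀ z : Fin (m + 1) → ℝ, HasDerivAt (fun t : ℝ => ψ (Fin.snoc (Fin.init z) t))
      (2 * z (Fin.last m)) (z (Fin.last m)) := by
    intro z
    have h := hasDerivAt_pow 2 (z (Fin.last m))
    simp only [hψ, Fin.snoc_last]
    simpa using h
  -- the substitution and its derivative
  set Φ : (Fin (m + 1) → ℝ) → (Fin (m + 1) → ℝ) := fun z => Fin.snoc (Fin.init z) (ψ z) with hΦ
  let Φ' : (Fin (m + 1) → ℝ) → (Fin (m + 1) → ℝ) →L[ℝ] (Fin (m + 1) → ℝ) := fun z =>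
    ContinuousLinearMap.pi
      (Fin.lastCases (motive := fun _ => (Fin (m + 1) → ℝ) →L[ℝ] ℝ) (fderiv ℝ ψ z)
        (fun i => ContinuousLinearMap.proj (Fin.castSucc i)))
  have hΦ' : ∀ z w, Φ' z w = Fin.snoc (Fin.init w) (fderiv ℝ ψ z w) := by
    intro z w
    funext i
    refine Fin.lastCases ?_ (fun j => ?_) i
    · simp [Φ']
    · simp [Φ', Fin.init]
  have hlast : ∀ z, fderiv ℝ ψ z (Pi.single (Fin.last m) 1) = 2 * z (Fin.last m) := by
    intro z
    have hγ : HasDerivAt (fun t : ℝ => (Fin.snoc (Fin.init z) t : Fin (m + 1) → ℝ))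
        (Pi.single (Fin.last m) (1 : ℝ)) (z (Fin.last m)) := by
      rw [hasDerivAt_pi]
      intro i
      refine Fin.lastCases ?_ (fun j => ?_) i
      · simpa using hasDerivAt_id' (z (Fin.last m))
      · simpa [(Fin.castSucc_lt_last j).ne, Fin.init] using
          hasDerivAt_const (z (Fin.last m)) (z (Fin.castSucc j))
    have h1 : HasDerivAt (fun t : ℝ => ψ (Fin.snoc (Fin.init z) t))
        (fderiv ℝ ψ z (Pi.single (Fin.last m) 1)) (z (Fin.last m)) := by
      have hψz : HasFDerivAt ψ (fderiv ℝ ψ z) (Fin.snoc (Fin.init z) (z (Fin.last m))) := by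
        rw [Fin.snoc_init_self]
        exact (hψd z).hasFDerivAt
      exact hψz.comp_hasDerivAt (z (Fin.last m)) hγ
    exact h1.unique (hψs z)
  have hdet : ∀ z, (Φ' z).det = 2 * z (Fin.last m) := by
    intro z
    let E : (Fin m → ℝ) →ₗ[ℝ] (Fin (m + 1) → ℝ) :=
      LinearMap.pi (Fin.lastCases (motive := fun _ => (Fin m → ℝ) →ₗ[ℝ] ℝ) 0
        (fun i => LinearMap.proj i))
    have hE : ∀ y, E y = Fin.snoc y 0 := by
      intro y
      funext i
      refine Fin.lastCases ?_ (fun j => ?_) i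
      · simp [E]
      · simp [E]
    have h := LinearMap.det_of_snoc_init (Φ' z : (Fin (m + 1) → ℝ) →ₗ[ℝ] (Fin (m + 1) → ℝ))
      LinearMap.id ((fderiv ℝ ψ z : (Fin (m + 1) → ℝ) →ₗ[ℝ] ℝ).comp E)
      (fderiv ℝ ψ z (Pi.single (Fin.last m) 1)) (fun w => by
        rw [ContinuousLinearMap.coe_coe, hΦ', LinearMap.id_apply, LinearMap.comp_apply,
          ContinuousLinearMap.coe_coe, hE]
        congr 1
        conv_lhs => rw [eq_snoc_init_zero_add' m w]
        rw [map_add, map_smul, smul_eq_mul, mul_comm])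
    rw [LinearMap.det_id, mul_one, hlast z] at h
    exact h
  have hderiv : ∀ z, HasFDerivAt Φ (Φ' z) z := by
    intro z
    rw [hasFDerivAt_pi']
    intro i
    refine Fin.lastCases ?_ (fun j => ?_) i
    · have hfun : (fun x => Φ x (Fin.last m)) = ψ := by
        funext x
        simp [hΦ]
      show HasFDerivAt (fun x => Φ x (Fin.last m)) _ z
      rw [hfun]
      refine (hψd z).hasFDerivAt.congr_fderiv (ContinuousLinearMap.ext fun w => ?_)
      simp [hΦ']
    · have hfun : (fun x => Φ x (Fin.castSucc j)) = fun x => x (Fin.castSucc j) := by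
        funext x
        simp [hΦ, Fin.init]
      show HasFDerivAt (fun x => Φ x (Fin.castSucc j)) _ z
      rw [hfun]
      refine (hasFDerivAt_apply (Fin.castSucc j) z).congr_fderiv
        (ContinuousLinearMap.ext fun w => ?_)
      simp [hΦ', Fin.init]
  -- injective on the cylinder, onto the cylinder
  have hinj : InjOn Φ r.domain := by
    intro z₁ hz₁ z₂ hz₂ h
    have hy : Fin.init z₁ = Fin.init z₂ := by
      have := congrArg Fin.init h
      simpa [hΦ] using this
    have hl : ψ z₁ = ψ z₂ := by
      have := congrFun h (Fin.last m)
      simpa [hΦ] using this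
    have h1 := hlast_mem z₁ hz₁
    have h2 := hlast_mem z₂ hz₂
    have hs : z₁ (Fin.last m) = z₂ (Fin.last m) :=
      (pow_left_inj₀ h1.1.le h2.1.le two_ne_zero).1 hl
    rw [← Fin.snoc_init_self z₁, ← Fin.snoc_init_self z₂, hy, hs]
  have himg : Φ '' r.domain = r.domain := by
    ext w
    simp only [mem_image]
    constructor
    · rintro ⟨z, hz, rfl⟩
      rw [hr] at hz ⊢
      refine ⟨?_, ?_⟩
      · show Fin.init (Fin.snoc (Fin.init z) (ψ z)) ∈ G
        rw [Fin.init_snoc]; exact hz.1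
      · show (Fin.snoc (Fin.init z) (ψ z) : Fin (m + 1) → ℝ) (Fin.last m) ∈ Ioo (0 : ℝ) 1
        rw [Fin.snoc_last]
        exact ⟨pow_pos hz.2.1 2, pow_lt_one₀ hz.2.1.le hz.2.2 two_ne_zero⟩
    · intro hw
      have hw' := hw
      rw [hr] at hw'
      refine ⟨Fin.snoc (Fin.init w) (Real.sqrt (w (Fin.last m))), ?_, ?_⟩
      · rw [hr]
        refine ⟨?_, ?_⟩
        · show Fin.init (Fin.snoc (Fin.init w) (Real.sqrt (w (Fin.last m)))) ∈ G
          rw [Fin.init_snoc]; exact hw'.1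
        · show (Fin.snoc (Fin.init w) (Real.sqrt (w (Fin.last m))) : Fin (m + 1) → ℝ) (Fin.last m) ∈
            Ioo (0 : ℝ) 1
          rw [Fin.snoc_last]
          exact ⟨Real.sqrt_pos.2 hw'.2.1,
            (Real.sqrt_lt' one_pos).2 (by rw [one_pow]; exact hw'.2.2)⟩
      · show Fin.snoc (Fin.init (Fin.snoc (Fin.init w) (Real.sqrt (w (Fin.last m)))))
            (ψ (Fin.snoc (Fin.init w) (Real.sqrt (w (Fin.last m))))) = w
        simp only [hψ, Fin.init_snoc, Fin.snoc_last]
        rw [Real.sq_sqrt hw'.2.1.le, Fin.snoc_init_self]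
  -- integrability of `g` on the cylinder, transported along `Φ`
  have hmeas : MeasurableSet r.domain := KZ.IntegralRep.measurableSet_domain_holds r
  have hpos2 : ∀ z ∈ r.domain, 0 < 2 * z (Fin.last m) := fun z hz => by
    have := (hlast_mem z hz).1; positivity
  have hgi : IntegrableOn g r.domain := by
    have key := (integrableOn_image_iff_integrableOn_abs_det_fderiv_smul (μ := volume) hmeas
      (fun z _ => (hderiv z).hasFDerivWithinAt) hinj g).2
    rw [himg] at key
    refine key (r.integrableOn.congr_fun (fun z hz => ?_) hmeas)
    rw [hint z hz, hdet z, abs_of_pos (hpos2 z hz), smul_eq_mul, mul_comm]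
  let r' : KZ.IntegralRep (m + 1) := ⟨r.domain, g, r.isSemialgebraic_domain, hg, hgi⟩
  refine ⟨r', rfl, rfl, ?_⟩
  refine KZ.changeOfVariablesRel_subset_relations
    ⟨m + 1, r, r', Φ, Φ', ?_, fun z _ => (hderiv z).hasFDerivWithinAt, hinj, himg.symm, ?_, rfl⟩
  · refine (isSemialgebraicMapOn_iff_forall_holds r.isSemialgebraic_domain).mpr fun i => ?_
    refine Fin.lastCases ?_ (fun j => ?_) i
    · exact (isSemialgebraicFunOn_aeval r.isSemialgebraic_domain
        ((MvPolynomial.X (Fin.last m)) ^ 2)).congr fun z _ => by simp [hΦ, hψ]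
    · exact (isSemialgebraicFunOn_aeval r.isSemialgebraic_domain
        (MvPolynomial.X (Fin.castSucc j))).congr fun z _ => by simp [hΦ, Fin.init]
  · intro z hz
    show r.integrand z = g (Φ z) * |(Φ' z).det|
    rw [hint z hz, hdet z, abs_of_pos (hpos2 z hz)]

/-- The functional identity `ℓ_{2j+1,2}(κ) = ℓ_{j,1}(κ)/2` (`w = θ²` in the fibre integral). -/
theorem ell_odd_two {κ : ℝ} (hκ : -1 < κ) (j : ℕ) : ell (2 * j + 1) 2 κ = ell j 1 κ / 2 := by
  have hden : ∀ u ∈ Icc (0 : ℝ) 1, 0 < 1 + u * κ := fun u hu => by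
    have := one_add_pow_mul_pos 1 hκ hu
    simpa using this
  have hg : ContinuousOn (fun u : ℝ => u ^ j / (1 + u * κ) / 2) (Icc (0 : ℝ) 1) := by
    refine ContinuousOn.div_const (ContinuousOn.div (by fun_prop) (by fun_prop) fun u hu => ?_) _
    exact (hden u hu).ne'
  have himg : (fun x : ℝ => x ^ 2) '' uIcc (0 : ℝ) 1 ⊆ Icc (0 : ℝ) 1 := by
    rw [uIcc_of_le zero_le_one]
    rintro _ ⟨x, hx, rfl⟩
    exact ⟨pow_nonneg hx.1 2, pow_le_one₀ hx.1 hx.2⟩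
  have key := intervalIntegral.integral_comp_mul_deriv' (a := (0 : ℝ)) (b := 1)
    (f := fun x : ℝ => x ^ 2) (f' := fun x : ℝ => 2 * x) (g := fun u : ℝ => u ^ j / (1 + u * κ) / 2)
    (fun x _ => by simpa using hasDerivAt_pow 2 x) (by fun_prop) (hg.mono himg)
  simp only [Function.comp] at key
  rw [ell, ell, ← integral_Ioc_eq_integral_Ioo, ← intervalIntegral.integral_of_le zero_le_one,
    ← integral_Ioc_eq_integral_Ioo, ← intervalIntegral.integral_of_le zero_le_one]
  have lhs : ∫ θ in (0 : ℝ)..1, kernel (2 * j + 1) 2 κ θ =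
      ∫ x in (0 : ℝ)..1, (x ^ 2) ^ j / (1 + x ^ 2 * κ) / 2 * (2 * x) := by
    refine intervalIntegral.integral_congr fun x _ => ?_
    simp only [kernel]
    rw [← pow_mul, pow_succ]
    ring
  have rhs : ∫ θ in (0 : ℝ)..1, kernel j 1 κ θ = ∫ u in (0 : ℝ)..1, u ^ j / (1 + u * κ) := by
    refine intervalIntegral.integral_congr fun u _ => ?_
    simp only [kernel, pow_one]
  rw [lhs, key, rhs]
  simp only [zero_pow two_ne_zero, one_pow]
  rw [intervalIntegral.integral_div]

end SqSubst

section MixedRigidity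

/-- Baker, mixed form: for algebraic `κ > 0`, `A + R₀ ℓ_{2n+2,2}(κ) + R₁ ℓ_{n+1,1}(κ) = 0` with algebraic
`A, R₀, R₁` forces `R₀ = R₁ = 0` (`ℓ_{2n+2,2}` is affine with non-zero algebraic slope in `arctan √κ/√κ`,
`ℓ_{n+1,1}` in `log(1+κ)/κ`; `CircleBaker.log_arctan`). [Baker1975 Thm 2.1] -/
theorem mixed_rem_scalar {κ A R₀ R₁ : ℝ} (hκ : 0 < κ) (hκa : IsAlgebraic ℚ κ) (hA : IsAlgebraic ℚ A)
    (h₀ : IsAlgebraic ℚ R₀) (h₁ : IsAlgebraic ℚ R₁) (n : ℕ)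
    (hrel : A + R₀ * ell (2 * n + 2) 2 κ + R₁ * ell (n + 1) 1 κ = 0) : R₀ = 0 ∧ R₁ = 0 := by
  have hκ1 : -1 < κ := by linarith
  have hκ0 : κ ≠ 0 := hκ.ne'
  obtain ⟨a, b, ha, hb, hb0, hE⟩ := ell_affine_mod hκ1 hκ0 hκa (2 * n + 2) 2
  obtain ⟨a', b', ha', hb', hb0', hO⟩ := ell_affine_mod hκ1 hκ0 hκa (n + 1) 1
  rw [show (2 * n + 2) % 2 = 0 by omega, ell_zero_two_pos hκ] at hE
  rw [Nat.mod_one, ell_zero_one hκ1 hκ0] at hO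
  set u := Real.sqrt κ with hu
  have hu0 : 0 < u := Real.sqrt_pos.2 hκ
  have hua : IsAlgebraic ℚ u := isAlgebraic_sqrt hκ.le hκa
  have h1κ : 0 < 1 + κ := by linarith
  have h1κa : IsAlgebraic ℚ (1 + κ) := isAlgebraic_one.add hκa
  -- the relation in Baker's format
  set c₁ : ℝ := R₁ * b' * κ⁻¹ with hc₁_def
  set c₂ : ℝ := R₀ * b * u⁻¹ with hc₂_def
  set c₀ : ℝ := -(A + R₀ * a + R₁ * a') with hc₀_def
  have ac₁ : IsAlgebraic ℚ c₁ := (h₁.mul hb').mul hκa.inv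
  have ac₂ : IsAlgebraic ℚ c₂ := (h₀.mul hb).mul hua.inv
  have ac₀ : IsAlgebraic ℚ c₀ := ((hA.add (h₀.mul ha)).add (h₁.mul ha')).neg
  have e1 : R₀ * ell (2 * n + 2) 2 κ = R₀ * a + c₂ * Real.arctan u := by
    rw [hE, div_eq_mul_inv]; ring
  have e2 : R₁ * ell (n + 1) 1 κ = R₁ * a' + c₁ * Real.log (1 + κ) := by
    rw [hO, div_eq_mul_inv]; ring
  have hsum : c₁ * Real.log (1 + κ) + c₂ * Real.arctan u = c₀ := by
    simp only [hc₀_def]; linarith [hrel, e1, e2]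
  obtain ⟨hc₀, hmix⟩ := CircleBaker.log_arctan h1κ h1κa hua ac₁ ac₂ ac₀ hsum
  have hlog : Real.log (1 + κ) ≠ 0 := Real.log_ne_zero_of_pos_of_ne_one h1κ (by linarith)
  have hatan : Real.arctan u ≠ 0 := fun h => hu0.ne' (Real.arctan_eq_zero_iff.mp h)
  have hR₁_of : c₁ = 0 → R₁ = 0 := fun hc => by
    have := mul_eq_zero.1 hc
    rcases this with h | h
    · exact (mul_eq_zero.1 h).resolve_right hb0'
    · exact absurd h (inv_ne_zero hκ0)
  have hR₀_of : c₂ = 0 → R₀ = 0 := fun hc => by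
    have := mul_eq_zero.1 hc
    rcases this with h | h
    · exact (mul_eq_zero.1 h).resolve_right hb0
    · exact absurd h (inv_ne_zero hu0.ne')
  by_cases hc₁ : c₁ = 0
  · have h2 : c₂ * Real.arctan u = 0 := by
      have := hsum; rw [hc₁, zero_mul, zero_add, hc₀] at this; exact this
    have hc₂ : c₂ = 0 := (mul_eq_zero.1 h2).resolve_right hatan
    exact ⟨hR₀_of hc₂, hR₁_of hc₁⟩
  · by_cases hc₂ : c₂ = 0
    · have h2 : c₁ * Real.log (1 + κ) = 0 := by
        have := hsum; rw [hc₂, zero_mul, add_zero, hc₀] at this; exact this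
      exact absurd ((mul_eq_zero.1 h2).resolve_right hlog) hc₁
    · have := (hmix hc₁ hc₂).1
      exact absurd (by linarith : κ = 0) hκ0

/-- **Mixed rigidity (even arctan-kind + log-kind remainder).** If
`g₀ + R₀ ℓ_{2n+2,2}(κ) + R₁ ℓ_{n+1,1}(κ) = 0` a.e. on `P` with all data `ℚ`-semialgebraic and
`κ > 0` on `P`, then `R₀ = 0` and `R₁ = 0` a.e. on `P` (smooth full-measure loci, continuity, the
algebraic points are dense, `mixed_rem_scalar` at each of them). [Baker1975 Thm 2.1; folklore] -/
theorem mixed_rem_ae_eq_zero {P : Set (Fin 1 → ℝ)} (hP : IsSemialgebraic ℚ P)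
    {g₀ R₀ R₁ κ : (Fin 1 → ℝ) → ℝ} (hg₀ : IsSemialgebraicFunOn ℚ P g₀)
    (hR₀ : IsSemialgebraicFunOn ℚ P R₀) (hR₁ : IsSemialgebraicFunOn ℚ P R₁)
    (hκs : IsSemialgebraicFunOn ℚ P κ) (hκ0 : ∀ x ∈ P, 0 < κ x) (n : ℕ)
    (hae : ∀ᵐ x, x ∈ P → g₀ x + R₀ x * ell (2 * n + 2) 2 (κ x) + R₁ x * ell (n + 1) 1 (κ x) = 0) :
    ∀ᵐ x, x ∈ P → R₀ x = 0 ∧ R₁ x = 0 := by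
  classical
  obtain ⟨O₁, hO₁G, hO₁o, -, hc₁, -, hn₁⟩ := KZ.exists_isOpen_contDiffOn hP hR₀
  obtain ⟨O₂, hO₂G, hO₂o, -, hc₂, -, hn₂⟩ := KZ.exists_isOpen_contDiffOn hP hκs
  obtain ⟨O₃, hO₃G, hO₃o, -, hc₃, -, hn₃⟩ := KZ.exists_isOpen_contDiffOn hP hg₀
  obtain ⟨O₄, hO₄G, hO₄o, -, hc₄, -, hn₄⟩ := KZ.exists_isOpen_contDiffOn hP hR₁
  set O := O₁ ∩ O₂ ∩ O₃ ∩ O₄ with hO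
  have hOo : IsOpen O := ((hO₁o.inter hO₂o).inter hO₃o).inter hO₄o
  have hOG : O ⊆ P := fun x hx => hO₁G hx.1.1.1
  have hnull : volume (P \ O) = 0 := by
    have hsub : P \ O ⊆ (P \ O₁) ∪ (P \ O₂) ∪ (P \ O₃) ∪ (P \ O₄) := by
      intro x hx
      simp only [hO, Set.mem_sdiff, mem_inter_iff, mem_union] at hx ⊢
      tauto
    have h0 : volume ((P \ O₁) ∪ (P \ O₂) ∪ (P \ O₃) ∪ (P \ O₄)) = 0 := by
      rw [measure_union_null_iff, measure_union_null_iff, measure_union_null_iff]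
      exact ⟨⟨⟨hn₁, hn₂⟩, hn₃⟩, hn₄⟩
    exact measure_mono_null hsub h0
  -- the defect function, continuous on `O` and zero a.e. there, hence zero on `O`
  set F : (Fin 1 → ℝ) → ℝ := fun x =>
    g₀ x + R₀ x * ell (2 * n + 2) 2 (κ x) + R₁ x * ell (n + 1) 1 (κ x) with hF
  have cR₀ : ContinuousOn R₀ O := hc₁.continuousOn.mono fun x hx => hx.1.1.1
  have cκ : ContinuousOn κ O := hc₂.continuousOn.mono fun x hx => hx.1.1.2
  have cg₀ : ContinuousOn g₀ O := hc₃.continuousOn.mono fun x hx => hx.1.2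
  have cR₁ : ContinuousOn R₁ O := hc₄.continuousOn.mono fun x hx => hx.2
  have hcont : ContinuousOn F O := by
    have c5 : ContinuousOn (fun x => ell (2 * n + 2) 2 (κ x)) O :=
      (continuousOn_ell _ 2).comp cκ fun x hx => by
        have := hκ0 x (hOG hx); show -1 < κ x; linarith
    have c6 : ContinuousOn (fun x => ell (n + 1) 1 (κ x)) O :=
      (continuousOn_ell _ 1).comp cκ fun x hx => by
        have := hκ0 x (hOG hx); show -1 < κ x; linarith
    exact (cg₀.add (cR₀.mul c5)).add (cR₁.mul c6)
  have hF0 : ∀ᵐ x, x ∈ O → F x = 0 := by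
    filter_upwards [hae] with x hx hxO
    exact hx (hOG hxO)
  have hFO : EqOn F 0 O := by
    have h1 : F =ᵐ[volume.restrict O] (0 : (Fin 1 → ℝ) → ℝ) :=
      (ae_restrict_iff' hOo.measurableSet).2 hF0
    exact Measure.eqOn_open_of_ae_eq h1 hOo hcont continuousOn_const
  -- at algebraic points of `O`: `R₀ = R₁ = 0`
  set A : Set (Fin 1 → ℝ) := {x | ∀ i, IsAlgebraic ℚ (x i)} with hA
  have hP_alg : ∀ x ∈ O ∩ A, R₀ x = 0 ∧ R₁ x = 0 := by
    rintro x ⟨hxO, hxA⟩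
    have hxG := hOG hxO
    exact mixed_rem_scalar (hκ0 x hxG) (hκs.isAlgebraic_apply hxG hxA)
      (hg₀.isAlgebraic_apply hxG hxA) (hR₀.isAlgebraic_apply hxG hxA)
      (hR₁.isAlgebraic_apply hxG hxA) n (hFO hxO)
  -- density + continuity
  have hD := dense_setOf_isAlgebraic.open_subset_closure_inter hOo
  have hR₀O : EqOn R₀ 0 O :=
    (show EqOn R₀ 0 (O ∩ A) from fun x hx => (hP_alg x hx).1).of_subset_closure cR₀
      continuousOn_const inter_subset_left hD
  have hR₁O : EqOn R₁ 0 O :=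
    (show EqOn R₁ 0 (O ∩ A) from fun x hx => (hP_alg x hx).2).of_subset_closure cR₁
      continuousOn_const inter_subset_left hD
  -- a.e. on `P`
  have hae' : ∀ᵐ x, x ∉ P \ O := measure_eq_zero_iff_ae_notMem.1 hnull
  filter_upwards [hae'] with x hx hxG
  by_cases hxO : x ∈ O
  · exact ⟨hR₀O hxO, hR₁O hxO⟩
  · exact absurd ⟨hxG, hxO⟩ hx

end MixedRigidity

end RegularisedLogLayer

end Summit.KontsevichZagierPeriods.RootDecompRelativeModAbsolute.Rung30571

end
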